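import Literature.NumberTheory.LFunctions.DirichletPolynomialLargeValues
import HarnessLib

/-!
# Large values of prime Dirichlet polynomials (Matomäki–Radziwiłł 2016, Lemma 8) with exponent `4`

Topic `NumberTheory/LFunctions`; a sharpening of the explicit constant in the exponential factor of
`MatomakiRadziwill2016_lemma8` (`DirichletPolynomialLargeValues.lean`).  That theorem renders the printed
`|𝒯| ≪ T^{2 log V/log P} V² exp(2 (log T/log P) log log T)` with one absolute constant `C` both in front
and in the exponent (`C = 8 max(C₇,1) + 16 ≥ 24`), which is all its docstring claims.  In §8.3 of the
paper, however, the size of the constant in the exponent matters: Lemma 8 is applied with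
`log P ≥ (2J²/η) log log X`, so the factor is `X^{cη/(2J²)}`, and the argument needs `c < 4J² + 2J`,
i.e. `c < 6` when `J = 1` (the paper's `c = 2`).  Here we prove, from Lemma 7 exactly as in the paper
and in `DirichletPolynomialLargeValues.lean` (whose combinatorial lemmas we reuse), the bound with
`c = 4` in the range `P² ≤ T`, `log log T ≥ 4` (in §8.3, `P ≤ Q_J ≤ exp(√log X)` and `T > X^{1/4}`):

* `MatomakiRadziwill2016_lemma8_sharp (h7) : ∃ C, … #𝒯 ≤ C V² T^{2 log V/log P} exp(4 (log T/log P) log log T)`,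
  `C = 8 max(C₇, 1)`.

The only change is the final absorption: with `ρ = log T/log P ≥ 2`, `k = ⌈ρ⌉ ≤ ρ + 1 ≤ 3ρ/2`,
`L = log log T ≥ 4`, `log k ≤ log(ρ+1) ≤ L + 1.4`:
`4^k · 4k · k! · log T ≤ 4 exp(k log 4 + log k + k log k + L) ≤ 4 exp(4 ρ L)` (`absorb_sharp`).

## References

* K. Matomäki, M. Radziwiłł, *Multiplicative functions in short intervals*, Ann. of Math. (2) 183
  (2016), 1015–1056, doi:10.4007/annals.2016.183.3.6, arXiv:1501.04585: §4 Lemma 8 (arXiv p. 11) and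
  §8.3 (its use, arXiv p. 17).
-/

noncomputable section

open Finset Real Complex

namespace Literature.NumberTheory.LFunctions

namespace DirichletLargeValues

/-- The sharp absorption: for `ρ ≥ 2`, `1 ≤ k ≤ ρ + 1`, `ρ ≤ 2 log T`, `L = log log T ≥ 4`:
`4^k · k · k^k · log T ≤ exp(4 ρ L)`. [folklore] -/
theorem absorb_sharp {k : ℕ} {ρ L T : ℝ} (hk1 : 1 ≤ k) (hk : (k : ℝ) ≤ ρ + 1) (hρ : 2 ≤ ρ)
    (hρT : ρ ≤ 2 * Real.log T) (hL : 4 ≤ L) (hLdef : Real.log (Real.log T) = L) :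
    (4 : ℝ) ^ k * k * (k : ℝ) ^ k * Real.log T ≤ Real.exp (4 * ρ * L) := by
  have hk0 : (0 : ℝ) < k := by exact_mod_cast hk1
  have hlog2 : Real.log 2 < 0.7 := by linarith [Real.log_two_lt_d9]
  have hlog4 : Real.log 4 < 1.4 := by
    rw [show (4:ℝ) = 2 ^ 2 by norm_num, Real.log_pow]; push_cast; linarith
  -- `log k ≤ log(ρ+1) ≤ log(2ρ) ≤ L + 1.4`
  have hlogk : Real.log k ≤ L + 1.4 := by
    have h1 : (k : ℝ) ≤ 2 * (2 * Real.log T) := by linarith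
    have h2 : Real.log k ≤ Real.log 4 + Real.log (Real.log T) := by
      rw [← Real.log_mul (by norm_num) (by linarith)]
      exact Real.log_le_log hk0 (by linarith)
    linarith
  have e1 : (4 : ℝ) ^ k = Real.exp (k * Real.log 4) := by
    rw [← Real.exp_log (show (0:ℝ) < 4 ^ k by positivity), Real.log_pow]
  have e2 : (k : ℝ) = Real.exp (Real.log k) := (Real.exp_log hk0).symm
  have e3 : (k : ℝ) ^ k = Real.exp (k * Real.log k) := by
    rw [← Real.exp_log (show (0:ℝ) < (k : ℝ) ^ k by positivity), Real.log_pow]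
  have e4 : Real.log T = Real.exp L := by rw [← hLdef, Real.exp_log (by linarith)]
  rw [e1, e3, e4]
  nth_rewrite 2 [e2]
  rw [← Real.exp_add, ← Real.exp_add, ← Real.exp_add, Real.exp_le_exp]
  -- `k log 4 + log k + k log k + L ≤ 4 ρ L`
  have hk' : (k : ℝ) ≤ 3 / 2 * ρ := by linarith
  have t1 : (k : ℝ) * Real.log 4 ≤ 3 / 2 * ρ * 1.4 := by nlinarith only [hk', hlog4, hk0]
  have t2 : (k : ℝ) * Real.log k ≤ 3 / 2 * ρ * (L + 1.4) := by nlinarith only [hk', hlogk, hk0, hL]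
  have hρL : 8 ≤ ρ * L := by nlinarith only [hρ, hL]
  nlinarith only [t1, t2, hlogk, hL, hρ, hρL]

set_option maxHeartbeats 800000 in
-- a single long explicit-constant bookkeeping proof (verbatim structure of `MatomakiRadziwill2016_lemma8`)
/-- **Matomäki–Radziwiłł 2016, Lemma 8, with exponent constant `4`** (PROVED from Lemma 7, hypothesis
`h7`): for `P(s) = ∑_{P ≤ p ≤ 2P} a_p p^{-s}` (`|a_p| ≤ 1`, `p` prime), a well-spaced `𝒯 ⊂ [-T, T]` with
`|P(1+it)| ≥ V⁻¹` on `𝒯`, and `2 ≤ P`, `P² ≤ T`, `T ≥ e^{e⁴}`, `V ≥ 1`: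
`#𝒯 ≤ C V² T^{2 log V/log P} exp(4 (log T/log P) log log T)`, `C = 8 max(C₇, 1)`.
The paper prints the exponential as `exp(2 (log T/log P) log log T)` (tacitly absorbing `5^k k!`,
`log(2(2P)^k)`, `k ≤ log T/log P + 1`); the constant `4` is what the printed five-line proof gives
honestly in this range (`absorb_sharp`), and any constant `< 6` serves §8.3 of the paper.
[cite: MatomakiRadziwillAnnals2016, Lemma 8] -/
theorem MatomakiRadziwill2016_lemma8_sharp (h7 : MatomakiRadziwill2016_lemma7) :
    ∃ C : ℝ, ∀ (P T V : ℝ) (a : ℕ → ℂ) (𝒯 : Finset ℝ), 2 ≤ P → P ^ 2 ≤ T →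
      Real.exp (Real.exp 4) ≤ T → 1 ≤ V → (∀ p, ‖a p‖ ≤ 1) → (∀ t ∈ 𝒯, |t| ≤ T) →
      (∀ t ∈ 𝒯, ∀ t' ∈ 𝒯, t ≠ t' → 1 ≤ |t - t'|) →
      (∀ t ∈ 𝒯, V⁻¹ ≤ ‖∑ p ∈ (Icc ⌈P⌉₊ ⌊2 * P⌋₊).filter Nat.Prime,
          a p * (p : ℂ) ^ (-(1 + (t : ℂ) * I))‖) →
      (#𝒯 : ℝ) ≤ C * V ^ 2 * T ^ (2 * Real.log V / Real.log P)
        * Real.exp (4 * (Real.log T / Real.log P) * Real.log (Real.log T)) := by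
  classical
  obtain ⟨C₇, H7⟩ := h7
  refine ⟨8 * max C₇ 1, ?_⟩
  intro P T V a 𝒯 hP hPT2 hT hV ha h𝒯T hws hlarge
  have hPT : P ≤ T := by nlinarith
  -- the set of primes and elementary facts
  set S := (Icc ⌈P⌉₊ ⌊2 * P⌋₊).filter Nat.Prime with hS
  have hSprime : ∀ p ∈ S, p.Prime := fun p hp => (Finset.mem_filter.mp hp).2
  have hSge : ∀ p ∈ S, ⌈P⌉₊ ≤ p := fun p hp => (Finset.mem_Icc.mp (Finset.mem_filter.mp hp).1).1
  have hSle : ∀ p ∈ S, p ≤ ⌊2 * P⌋₊ := fun p hp => (Finset.mem_Icc.mp (Finset.mem_filter.mp hp).1).2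
  have hP0 : 0 < P := by linarith
  have hee : Real.exp 4 ≤ Real.log T := by
    rw [← Real.log_exp (Real.exp 4)]; exact Real.log_le_log (Real.exp_pos _) hT
  have he1 : 1 ≤ Real.exp 4 := Real.one_le_exp (by norm_num)
  have hlogT1 : 1 ≤ Real.log T := he1.trans hee
  have hT1 : 1 ≤ T := by
    have : Real.exp (Real.exp 4) ≥ 1 := Real.one_le_exp (by positivity)
    linarith
  have hT0 : 0 < T := by linarith
  have hL4 : 4 ≤ Real.log (Real.log T) := by
    rw [← Real.log_exp 4]; exact Real.log_le_log (Real.exp_pos 4) hee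
  have hL1 : 1 ≤ Real.log (Real.log T) := by linarith
  set L := Real.log (Real.log T) with hLdef
  have hlog2 : (1 : ℝ) / 2 ≤ Real.log 2 := by
    have := Real.add_one_le_exp (Real.log 2)
    rw [Real.exp_log (by norm_num)] at this
    -- log 2 ≥ 1 - 1/2 via exp(1/2) ≤ 2
    by_contra hcon
    push Not at hcon
    have h1 : Real.exp (Real.log 2) < Real.exp (1 / 2) := Real.exp_lt_exp.mpr hcon
    rw [Real.exp_log (by norm_num)] at h1
    have h2 : Real.exp (1 / 2 : ℝ) ≤ 2 := by
      have h3 : Real.exp (1 / 2 : ℝ) ^ 2 = Real.exp 1 := by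
        rw [← Real.exp_nat_mul]; norm_num
      nlinarith [Real.exp_one_lt_d9, Real.exp_pos (1 / 2 : ℝ)]
    linarith
  have hlogP : Real.log 2 ≤ Real.log P := Real.log_le_log (by norm_num) hP
  have hlogP0 : 0 < Real.log P := by linarith
  have hlogPT : Real.log P ≤ Real.log T := Real.log_le_log hP0 hPT
  -- `ρ = log T / log P ≥ 1`, `k = ⌈ρ⌉`
  set ρ := Real.log T / Real.log P with hρ
  have hρ2 : 2 ≤ ρ := by
    rw [hρ, le_div_iff₀ hlogP0]
    have : Real.log (P ^ 2) ≤ Real.log T := Real.log_le_log (by positivity) hPT2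
    rw [Real.log_pow] at this
    push_cast at this
    linarith
  have hρ1 : 1 ≤ ρ := by linarith
  have hρT : ρ ≤ 2 * Real.log T := by
    rw [hρ, div_le_iff₀ hlogP0]; nlinarith
  set k := ⌈ρ⌉₊ with hk
  have hkρ : ρ ≤ k := Nat.le_ceil ρ
  have hk1 : 1 ≤ k := by
    have : (0 : ℝ) < k := by linarith
    exact_mod_cast this
  have hkρ' : (k : ℝ) ≤ ρ + 1 := (Nat.ceil_lt_add_one (by linarith)).le
  have hk2ρ : (k : ℝ) ≤ 2 * ρ := by linarith
  have hk0 : (0 : ℝ) < k := by exact_mod_cast hk1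
  -- `T ≤ P^k`
  have hPk : T ≤ P ^ k := by
    have h1 : Real.log T ≤ k * Real.log P := by
      have := mul_le_mul_of_nonneg_right hkρ hlogP0.le
      rwa [hρ, div_mul_cancel₀ _ hlogP0.ne'] at this
    calc T = Real.exp (Real.log T) := (Real.exp_log hT0).symm
      _ ≤ Real.exp (k * Real.log P) := Real.exp_le_exp.mpr h1
      _ = P ^ k := by rw [← Real.log_pow, Real.exp_log (by positivity)]
  -- `N = ⌊2P⌋^k`
  set M := ⌊2 * P⌋₊ with hM
  have hM1 : 1 ≤ M := Nat.le_floor (by push_cast; linarith)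
  have hMle : (M : ℝ) ≤ 2 * P := Nat.floor_le (by linarith)
  set N := M ^ k with hN
  have hN1 : 1 ≤ N := Nat.one_le_pow _ _ hM1
  have hprod : ∀ u ∈ Fintype.piFinset (fun _ : Fin k => S), ∏ i, u i ∈ Icc 1 N := by
    intro u hu
    rw [Fintype.mem_piFinset] at hu
    rw [Finset.mem_Icc]
    constructor
    · exact Nat.one_le_iff_ne_zero.mpr (Finset.prod_ne_zero_iff.mpr fun i _ =>
        (hSprime _ (hu i)).ne_zero)
    · calc ∏ i, u i ≤ ∏ _i : Fin k, M := Finset.prod_le_prod' fun i _ => hSle _ (hu i)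
        _ = N := by simp [hN]
  -- the coefficients of `P(s)^k`
  set c : ℕ → ℂ := fun n =>
    (∑ u ∈ (Fintype.piFinset fun _ : Fin k => S).filter (fun u => ∏ i, u i = n), ∏ i, a (u i))
      * (n : ℂ)⁻¹ with hc
  have hpow : ∀ t : ℝ, (∑ p ∈ S, a p * (p : ℂ) ^ (-(1 + (t : ℂ) * I))) ^ k
      = ∑ n ∈ Icc 1 N, c n * (n : ℂ) ^ (-((t : ℂ) * I)) := by
    intro t
    rw [pow_sum_eq_sum_fiber k S a (1 + t * I) N hprod]
    refine Finset.sum_congr rfl fun n hn => ?_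
    have hn0 : (n : ℂ) ≠ 0 := by
      have : 1 ≤ n := (Finset.mem_Icc.mp hn).1
      exact_mod_cast (show n ≠ 0 by omega)
    simp only [hc]
    rw [mul_assoc]
    congr 1
    rw [neg_add, Complex.cpow_add _ _ hn0, Complex.cpow_neg_one]
  -- Lemma 7
  have h7' := H7 N c T 𝒯 hN1 hT1 h𝒯T hws
  -- lower bound by the large values
  have hlow : (#𝒯 : ℝ) * (V ^ (2 * k))⁻¹
      ≤ ∑ t ∈ 𝒯, ‖∑ n ∈ Icc 1 N, c n * (n : ℂ) ^ (-((t : ℂ) * I))‖ ^ 2 := by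
    rw [Finset.card_eq_sum_ones, Nat.cast_sum, Finset.sum_mul]
    refine Finset.sum_le_sum fun t ht => ?_
    rw [Nat.cast_one, one_mul, ← hpow t, norm_pow, ← pow_mul, ← inv_pow, mul_comm]
    exact pow_le_pow_left₀ (by positivity) (hlarge t ht) _
  -- size of the coefficients
  have hSsum : ∑ p ∈ S, ((p : ℝ) ^ 2)⁻¹ ≤ 2 / P := by
    have h1 : ∀ p ∈ S, ((p : ℝ) ^ 2)⁻¹ ≤ (P ^ 2)⁻¹ := fun p hp => by
      have : P ≤ p := (Nat.le_ceil P).trans (by exact_mod_cast hSge p hp)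
      gcongr
    have hcard : (#S : ℝ) ≤ P + 1 := by
      have h2 : #S ≤ #(Icc ⌈P⌉₊ ⌊2 * P⌋₊) := Finset.card_filter_le _ _
      rw [Nat.card_Icc] at h2
      have h3 : (#S : ℝ) ≤ ((⌊2 * P⌋₊ + 1 - ⌈P⌉₊ : ℕ) : ℝ) := by exact_mod_cast h2
      refine h3.trans ?_
      have h4 := Nat.le_ceil P
      rcases le_or_gt ⌈P⌉₊ (⌊2 * P⌋₊ + 1) with h5 | h5
      · rw [Nat.cast_sub h5]; push_cast; linarith
      · rw [Nat.sub_eq_zero_of_le h5.le]; simp; linarith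
    calc ∑ p ∈ S, ((p : ℝ) ^ 2)⁻¹ ≤ ∑ p ∈ S, (P ^ 2)⁻¹ := Finset.sum_le_sum h1
      _ = #S * (P ^ 2)⁻¹ := by rw [Finset.sum_const, nsmul_eq_mul]
      _ ≤ (P + 1) * (P ^ 2)⁻¹ := by gcongr
      _ ≤ 2 / P := by
          rw [div_eq_mul_inv]
          have : (P + 1) * (P ^ 2)⁻¹ = ((P + 1) / P) * P⁻¹ := by field_simp
          rw [this]
          apply mul_le_mul_of_nonneg_right _ (by positivity)
          rw [div_le_iff₀ hP0]; linarith
  have hcoef : ∑ n ∈ Icc 1 N, ‖c n‖ ^ 2 ≤ k.factorial * (2 / P) ^ k := by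
    -- `‖c n‖ ≤ m(n)/n`, `m(n) ≤ k!`
    set F : ℕ → Finset (Fin k → ℕ) := fun n =>
      (Fintype.piFinset fun _ : Fin k => S).filter (fun u => ∏ i, u i = n) with hF
    have hm : ∀ n, (#(F n) : ℝ) ≤ k.factorial := fun n => by
      exact_mod_cast card_filter_prod_eq_le_factorial k S hSprime n
    have hcn : ∀ n ∈ Icc 1 N, ‖c n‖ ≤ #(F n) * (n : ℝ)⁻¹ := by
      intro n hn
      have hn1 : (1 : ℝ) ≤ n := by exact_mod_cast (Finset.mem_Icc.mp hn).1
      simp only [hc, hF]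
      rw [norm_mul, norm_inv, Complex.norm_natCast]
      apply mul_le_mul_of_nonneg_right _ (by positivity)
      refine (norm_sum_le _ _).trans ?_
      calc ∑ u ∈ (Fintype.piFinset fun _ : Fin k => S).filter (fun u => ∏ i, u i = n), ‖∏ i, a (u i)‖
          ≤ ∑ u ∈ (Fintype.piFinset fun _ : Fin k => S).filter (fun u => ∏ i, u i = n), (1 : ℝ) := by
            refine Finset.sum_le_sum fun u _ => ?_
            rw [norm_prod]
            exact Finset.prod_le_one (fun i _ => norm_nonneg _) fun i _ => ha _
        _ = #((Fintype.piFinset fun _ : Fin k => S).filter (fun u => ∏ i, u i = n)) := by simp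
    have hsq : ∀ n ∈ Icc 1 N, ‖c n‖ ^ 2 ≤ k.factorial * ((#(F n) : ℝ) * ((n : ℝ) ^ 2)⁻¹) := by
      intro n hn
      have h1 := hcn n hn
      have h2 := hm n
      have h0 : 0 ≤ (#(F n) : ℝ) * (n : ℝ)⁻¹ := by positivity
      calc ‖c n‖ ^ 2 ≤ (#(F n) * (n : ℝ)⁻¹) ^ 2 := pow_le_pow_left₀ (norm_nonneg _) h1 2
        _ = #(F n) * (#(F n) * ((n : ℝ) ^ 2)⁻¹) := by ring
        _ ≤ k.factorial * (#(F n) * ((n : ℝ) ^ 2)⁻¹) :=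
            mul_le_mul_of_nonneg_right h2 (by positivity)
    calc ∑ n ∈ Icc 1 N, ‖c n‖ ^ 2
        ≤ ∑ n ∈ Icc 1 N, k.factorial * ((#(F n) : ℝ) * ((n : ℝ) ^ 2)⁻¹) := Finset.sum_le_sum hsq
      _ = k.factorial * ∑ u ∈ Fintype.piFinset (fun _ : Fin k => S), (((∏ i, u i : ℕ) : ℝ) ^ 2)⁻¹ := by
          rw [← Finset.mul_sum, sum_card_fiber_mul k S (fun n => ((n : ℝ) ^ 2)⁻¹) N hprod]
      _ = k.factorial * (∑ p ∈ S, ((p : ℝ) ^ 2)⁻¹) ^ k := by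
          congr 1
          have : (∑ p ∈ S, ((p : ℝ) ^ 2)⁻¹) ^ k = ∏ _i : Fin k, ∑ p ∈ S, ((p : ℝ) ^ 2)⁻¹ := by simp
          rw [this, Finset.prod_univ_sum]
          refine Finset.sum_congr rfl fun u _ => ?_
          rw [Nat.cast_prod, ← Finset.prod_pow, ← Finset.prod_inv_distrib]
      _ ≤ k.factorial * (2 / P) ^ k := by
          gcongr
  -- combine
  have hC₇ : C₇ ≤ max C₇ 1 := le_max_left _ _
  have hsum0 : 0 ≤ ∑ n ∈ Icc 1 N, ‖c n‖ ^ 2 := Finset.sum_nonneg fun n _ => by positivity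
  have hNle : (N : ℝ) ≤ (2 * P) ^ k := by
    rw [hN]; push_cast
    exact pow_le_pow_left₀ (by positivity) hMle k
  have hlogN : Real.log (2 * N) ≤ 4 * k * Real.log T := by
    have hN0 : (0 : ℝ) < N := by exact_mod_cast hN1
    have h1 : Real.log (2 * N) ≤ Real.log 2 + k * Real.log (2 * P) := by
      rw [Real.log_mul (by norm_num) hN0.ne', ← Real.log_pow]
      gcongr
    have h2 : Real.log (2 * P) ≤ 2 * Real.log T := by
      have h5 : Real.log (2 * P) ≤ Real.log (T ^ 2) :=
        Real.log_le_log (by linarith) (by nlinarith)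
      have h6 : Real.log (T ^ 2) = 2 * Real.log T := by
        rw [Real.log_pow]; push_cast; ring
      linarith
    have h3 : Real.log 2 ≤ Real.log T := (hlogP.trans hlogPT)
    have h4 : (1 : ℝ) ≤ k := by exact_mod_cast hk1
    nlinarith
  have hmain : (#𝒯 : ℝ) * (V ^ (2 * k))⁻¹
      ≤ max C₇ 1 * (2 * 4 ^ k) * (4 * k * Real.log T) * k.factorial := by
    refine hlow.trans (h7'.trans ?_)
    have hTN : 0 ≤ T + N := by positivity
    have hlogN0 : 0 ≤ Real.log (2 * N) := Real.log_nonneg (by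
      have : (1:ℝ) ≤ N := by exact_mod_cast hN1
      linarith)
    calc C₇ * (T + N) * Real.log (2 * N) * ∑ n ∈ Icc 1 N, ‖c n‖ ^ 2
        ≤ max C₇ 1 * (T + N) * Real.log (2 * N) * (k.factorial * (2 / P) ^ k) := by
          have : C₇ * (T + N) * Real.log (2 * N) ≤ max C₇ 1 * (T + N) * Real.log (2 * N) := by
            gcongr
          calc _ ≤ max C₇ 1 * (T + N) * Real.log (2 * N) * ∑ n ∈ Icc 1 N, ‖c n‖ ^ 2 :=
                mul_le_mul_of_nonneg_right this hsum0
            _ ≤ _ := mul_le_mul_of_nonneg_left hcoef (by positivity)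
      _ = max C₇ 1 * ((T + N) * (2 / P) ^ k) * Real.log (2 * N) * k.factorial := by ring
      _ ≤ max C₇ 1 * (2 * 4 ^ k) * (4 * k * Real.log T) * k.factorial := by
          have hTP : (T + N) * (2 / P) ^ k ≤ 2 * 4 ^ k := by
            rw [div_pow, add_mul]
            have e1 : T * (2 ^ k / P ^ k) ≤ 2 ^ k := by
              rw [mul_div_assoc', div_le_iff₀ (by positivity)]
              nlinarith [pow_pos (show (0:ℝ) < 2 by norm_num) k]
            have e2 : (N : ℝ) * (2 ^ k / P ^ k) ≤ 4 ^ k := by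
              calc (N : ℝ) * (2 ^ k / P ^ k) ≤ (2 * P) ^ k * (2 ^ k / P ^ k) := by gcongr
                _ = 4 ^ k := by
                    rw [mul_pow, show (4 : ℝ) ^ k = 2 ^ k * 2 ^ k by rw [← mul_pow]; norm_num]
                    field_simp
            have e3 : (2 : ℝ) ^ k ≤ 4 ^ k := pow_le_pow_left₀ (by norm_num) (by norm_num) k
            linarith
          gcongr
  -- final absorption
  have hfact : (k.factorial : ℝ) ≤ (k : ℝ) ^ k := by exact_mod_cast Nat.factorial_le_pow k
  have habs := absorb_sharp hk1 hkρ' hρ2 hρT hL4 hLdef.symm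
  have hV2k : V ^ (2 * k) ≤ V ^ 2 * T ^ (2 * Real.log V / Real.log P) := by
    have hV0 : 0 < V := by linarith
    have e1 : V ^ (2 * k) = Real.exp (2 * k * Real.log V) := by
      rw [← Real.exp_log (pow_pos hV0 _), Real.log_pow]; push_cast; ring_nf
    have e2 : V ^ 2 * T ^ (2 * Real.log V / Real.log P) = Real.exp (2 * (ρ + 1) * Real.log V) := by
      rw [Real.rpow_def_of_pos hT0, ← Real.exp_log (pow_pos hV0 2), Real.log_pow, ← Real.exp_add]
      congr 1
      rw [hρ]; push_cast; field_simp; ring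
    rw [e1, e2, Real.exp_le_exp]
    have := Real.log_nonneg hV
    nlinarith
  -- assemble: #𝒯 ≤ V^{2k} · 8 C⁺ · (4^k k k^k log T)
  have hVpos : 0 < V ^ (2 * k) := by positivity
  have step1 : (#𝒯 : ℝ) ≤ V ^ (2 * k) * (max C₇ 1 * (2 * 4 ^ k) * (4 * k * Real.log T) * k.factorial) := by
    have h := hmain
    rw [← div_eq_mul_inv, div_le_iff₀ hVpos] at h
    calc (#𝒯 : ℝ) ≤ max C₇ 1 * (2 * 4 ^ k) * (4 * k * Real.log T) * k.factorial * V ^ (2 * k) := h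
      _ = _ := mul_comm _ _
  have step2 : max C₇ 1 * (2 * 4 ^ k) * (4 * k * Real.log T) * (k.factorial : ℝ)
      ≤ 8 * max C₇ 1 * Real.exp (4 * ρ * L) := by
    have h1 : max C₇ 1 * (2 * 4 ^ k) * (4 * k * Real.log T) * (k.factorial : ℝ)
        ≤ max C₇ 1 * (2 * 4 ^ k) * (4 * k * Real.log T) * (k : ℝ) ^ k :=
      mul_le_mul_of_nonneg_left hfact (by positivity)
    refine h1.trans ?_
    calc max C₇ 1 * (2 * 4 ^ k) * (4 * k * Real.log T) * (k : ℝ) ^ k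
        = 8 * max C₇ 1 * ((4 : ℝ) ^ k * k * (k : ℝ) ^ k * Real.log T) := by ring
      _ ≤ 8 * max C₇ 1 * Real.exp (4 * ρ * L) :=
          mul_le_mul_of_nonneg_left habs (by positivity)
  calc (#𝒯 : ℝ) ≤ V ^ (2 * k) * (8 * max C₇ 1 * Real.exp (4 * ρ * L)) :=
        step1.trans (mul_le_mul_of_nonneg_left step2 hVpos.le)
    _ ≤ (V ^ 2 * T ^ (2 * Real.log V / Real.log P)) * (8 * max C₇ 1 * Real.exp (4 * ρ * L)) :=
        mul_le_mul_of_nonneg_right hV2k (by positivity)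
    _ = 8 * max C₇ 1 * V ^ 2 * T ^ (2 * Real.log V / Real.log P)
          * Real.exp (4 * (Real.log T / Real.log P) * Real.log (Real.log T)) := by
        rw [← hρ, ← hLdef]; ring



end DirichletLargeValues

end Literature.NumberTheory.LFunctions
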